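import Summits.KontsevichZagierPeriods.KontsevichZagierPeriods.Theorems.OctahedralSymmetryOctahedralSpanAllWeightsBinaryInterior
import HarnessLib

/-!
# Crux `OctahedralSpanAllWeights` (stmt-KontsevichZagierPeriods-9659), line `Sketch`, block F1:
# interior words AVOIDING one unit letter reduce by ONE finite double shuffle (all weights, all depths)

**Theorem `interiorAvoiding`.** Let `c ∈ {1, 2, 3}` and let `k` be a level-4 index with all parts `sⱼ ≥ 2`
whose cumulative exponent sums avoid `0` and `c`; equivalently `word k` is an `e₁`-free word
`4^{s₁−1} c₁ ⋯ 4^{s_d−1} c_d` with EVERY block of `4` nonempty and NOT using the unit letter `−c`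
(pole `i^{−c}`).  Then `[word k] ∈ rel ⊔ RegularE0.e0Lower (word k)` (block F1's target: `e₁`-free
convergent words of the same length with fewer letters `4`).  The generator: the finite double
shuffle of `k₀` (parts `sⱼ − 1`, first exponent lowered by `c`) with `l = ((1,c),(1,0),…,(1,0))`
(word: the letter `−c` repeated `d` times); its unique minimal-depth stuffle term is the componentwise
merge `k` (`filter_stuffleIdx_length_eq`, file …BinaryInterior), and all its other terms are
`e₁`-free because every cumulative sum met along a stuffle is `p` or `p + c` with `p ∉ {0, −c}`, or
`0 + c` (`e1ok_stuffle_av`), with fewer letters `4`.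

`c = 2` is `binaryInterior` (…BinaryInterior p126041); `c = 1` and `c = 3` give the interior words over
`{2, 3, 4}` resp. `{1, 2, 4}`; together: EVERY interior `e₁`-free word that misses at least one of the
three unit letters reduces by one generator.  Not covered: "tricolour" interior words (all of `1, 2, 3`
occur) and the boundary of the exponent simplex (an empty block of `4`), where the top terms of the
available double shuffles are no longer single (depth three: …DepthThreeBinary; in general the
boundary couples to `2`-prefixed words — lab exp12 of the c1 session).

Sources: J. Zhao, Doc. Math. 15 (2010), §2 Def. 2.4, (FDS) [Zhao2010].
-/

noncomputable section

namespace Summit.KontsevichZagierPeriods.OctahedralSymmetry.OctaSpan.RegularE0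

open Literature.NumberTheory.Transcendental Literature.NumberTheory.Transcendental.LevelFour

/-! ## II. Interior words AVOIDING one unit letter: the same one-generator kill with `l = ((1,c),(1,0),…)` -/

/-- Boolean check: cumulative sums from `a` avoid `0` and the value `v`. [folklore] -/
def psAv (v : Fin 4) : Fin 4 → List (Fin 4) → Bool
  | _, [] => true
  | a, e :: es => (decide (a + e ≠ 0) && decide (a + e ≠ v)) && psAv v (a + e) es

/-- Boolean check: cumulative sums from `b` are all equal to `c`. [folklore] -/
def psConst (c : Fin 4) : Fin 4 → List (Fin 4) → Bool
  | _, [] => true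
  | b, f :: fs => decide (b + f = c) && psConst c (b + f) fs

/-- Unfolding `psAv` on a cons. [folklore] -/
theorem psAv_cons {v a e : Fin 4} {es : List (Fin 4)} :
    psAv v a (e :: es) = true ↔ (a + e ≠ 0 ∧ a + e ≠ v) ∧ psAv v (a + e) es = true := by
  simp [psAv]

/-- Unfolding `psConst` on a cons. [folklore] -/
theorem psConst_cons {c b f : Fin 4} {fs : List (Fin 4)} :
    psConst c b (f :: fs) = true ↔ b + f = c ∧ psConst c (b + f) fs = true := by
  simp [psConst]

/-- `e1ok` of a list whose cumulative sums from `a` avoid `0` and `−c`, read from `a + b` with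
`b ∈ {0, c}`. [folklore] -/
theorem e1ok_of_psAv (c : Fin 4) : ∀ (a b : Fin 4) (es : List (Fin 4)), (b = 0 ∨ b = c) →
    psAv (-c) a es = true → e1ok (a + b) es = true
  | _, _, [], _, _ => rfl
  | a, b, e :: es, hb, h => by
    obtain ⟨⟨h1, h2⟩, h3⟩ := psAv_cons.1 h
    have ih := e1ok_of_psAv c (a + e) b es hb h3
    have hne : a + b + e ≠ 0 := by
      rw [add_right_comm]
      rcases hb with rfl | rfl
      · rwa [add_zero]
      · intro h0; exact h2 (eq_neg_of_add_eq_zero_left h0)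
    rw [add_right_comm a e b] at ih
    simp [e1ok, ih, hne]

/-- `e1ok` of a list whose cumulative sums from `b` are all `c`, read from `a + b` with `a + c ≠ 0`.
[folklore] -/
theorem e1ok_of_psConst (c : Fin 4) : ∀ (a b : Fin 4) (fs : List (Fin 4)), a + c ≠ 0 →
    psConst c b fs = true → e1ok (a + b) fs = true
  | _, _, [], _, _ => rfl
  | a, b, f :: fs, ha, h => by
    obtain ⟨h1, h2⟩ := psConst_cons.1 h
    have ih := e1ok_of_psConst c a (b + f) fs ha h2
    have hne : a + b + f ≠ 0 := by rwa [add_assoc, h1]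
    rw [← add_assoc] at ih
    simp [e1ok, ih, hne]

/-- **Stuffles of an index whose cumulative poles avoid `0, −c` with a `c`-constant one are `e₁`-free.**
[folklore] -/
theorem e1ok_stuffle_av (c : Fin 4) : ∀ (k l : List (ℕ × Fin 4)) (a b : Fin 4), a + c ≠ 0 →
    (b = 0 ∨ b = c) → psAv (-c) a (k.map Prod.snd) = true → psConst c b (l.map Prod.snd) = true →
    ∀ j ∈ stuffleIdx k l, e1ok (a + b) (j.map Prod.snd) = true
  | [], l, a, b, ha, _, _, hl, j, hj => by
    rw [stuffleIdx_nil_left, List.mem_singleton] at hj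
    subst hj
    exact e1ok_of_psConst c a b _ ha hl
  | p :: k, [], a, b, _, hb, hk, _, j, hj => by
    rw [stuffleIdx_nil_right, List.mem_singleton] at hj
    subst hj
    exact e1ok_of_psAv c a b _ hb hk
  | p :: k, q :: l, a, b, ha, hb, hk, hl, j, hj => by
    rw [List.map_cons] at hk hl
    obtain ⟨⟨hk1, hk1'⟩, hk2⟩ := psAv_cons.1 hk
    obtain ⟨hl1, hl2⟩ := psConst_cons.1 hl
    have ha' : a + p.2 + c ≠ 0 := fun h0 => hk1' (eq_neg_of_add_eq_zero_left h0)
    rw [stuffleIdx_cons_cons, List.mem_append, List.mem_append, List.mem_map, List.mem_map,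
      List.mem_map] at hj
    rcases hj with ⟨j, hj, rfl⟩ | ⟨j, hj, rfl⟩ | ⟨j, hj, rfl⟩
    · have ih := e1ok_stuffle_av c k (q :: l) (a + p.2) b ha' hb hk2
        (by rw [List.map_cons]; exact psConst_cons.2 ⟨hl1, hl2⟩) j hj
      have hne : a + b + p.2 ≠ 0 := by
        rw [add_right_comm]
        rcases hb with rfl | rfl
        · rwa [add_zero]
        · exact ha'
      rw [add_right_comm a p.2 b] at ih
      simp [e1ok, ih, hne]
    · have ih := e1ok_stuffle_av c (p :: k) l a (b + q.2) ha (Or.inr hl1)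
        (by rw [List.map_cons]; exact psAv_cons.2 ⟨⟨hk1, hk1'⟩, hk2⟩) hl2 j hj
      have hne : a + b + q.2 ≠ 0 := by rwa [add_assoc, hl1]
      rw [← add_assoc] at ih
      simp [e1ok, ih, hne]
    · have ih := e1ok_stuffle_av c k l (a + p.2) (b + q.2) ha' (Or.inr hl1) hk2 hl2 j hj
      have hne : a + b + (p.2 + q.2) ≠ 0 := by
        rw [show a + b + (p.2 + q.2) = (a + p.2) + (b + q.2) from by abel, hl1]; exact ha'
      rw [show a + p.2 + (b + q.2) = a + b + (p.2 + q.2) from by abel] at ih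
      simp [e1ok, ih, hne]
  termination_by k l => k.length + l.length

/-- Shifting the start by `−c` turns "avoid `0, c`" into "avoid `0, −c`"… precisely: cumulative sums
avoiding `0` and `c` from `a` avoid `−c` and `0` from `a − c`. [folklore] -/
theorem psAv_shift (c : Fin 4) : ∀ (a : Fin 4) (es : List (Fin 4)), psAv c a es = true →
    psAv (-c) (a - c) es = true
  | _, [], _ => rfl
  | a, e :: es, h => by
    obtain ⟨⟨h1, h2⟩, h3⟩ := psAv_cons.1 h
    refine psAv_cons.2 ⟨⟨?_, ?_⟩, by rw [sub_add_eq_add_sub]; exact psAv_shift c (a + e) es h3⟩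
    · rw [sub_add_eq_add_sub]; exact fun h0 => h2 (sub_eq_zero.1 h0)
    · rw [sub_add_eq_add_sub]; intro h0
      exact h1 (by have := congrArg (· + c) h0; simpa using this)

/-- The exponent list `(0, …, 0)` keeps the cumulative sum at `c`. [folklore] -/
theorem psConst_zeros (c : Fin 4) : ∀ n : ℕ, psConst c c ((List.replicate n ((1 : ℕ), (0 : Fin 4))).map Prod.snd) = true
  | 0 => rfl
  | n + 1 => psConst_cons.2 ⟨by rw [add_zero], by rw [add_zero]; exact psConst_zeros c n⟩

/-- **Interior words AVOIDING a unit letter (all weights, all depths).** Let `k` be an index with all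
parts `sⱼ ≥ 2` whose cumulative exponent sums avoid `0` and a fixed nonzero value `c` — i.e. `word k` is an
`e₁`-free word with every block of `4` nonempty which does NOT use the unit letter `−c` (pole `i^{−c}`).
Then `[word k] ∈ rel ⊔ e0Lower (word k)`: the finite double shuffle of `k₀` (parts `sⱼ − 1`, first exponent
`− c`) with `l = ((1,c),(1,0),…,(1,0))` (word: the letter `−c` repeated) has `k` as its unique minimal-depth
stuffle term and all other terms `e₁`-free (`e1ok_stuffle_av`) with fewer letters `4`.  For `c = 2` this is
`binaryInterior`; `c = 1, 3` give the interior words over `{1, 2, 4}` and over `{2, 3, 4}` (and every interior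
word missing at least one of the letters `1, 2, 3`).  Only "tricolour" interior words are not covered.
[cite: Zhao2010, §2 (FDS)] -/
theorem interiorAvoiding (c : Fin 4) (hc : c ≠ 0) (k : List (ℕ × Fin 4)) (hk : k ≠ [])
    (hs : ∀ p ∈ k, 2 ≤ p.1) (hav : psAv c 0 (k.map Prod.snd) = true) :
    sym (word k) ∈ rel ⊔ e0Lower (word k) := by
  obtain ⟨p₀, t, rfl⟩ := List.exists_cons_of_ne_nil hk
  set k₀ : List (ℕ × Fin 4) := (p₀.1 - 1, p₀.2 - c) :: lowerParts t with hk₀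
  set l : List (ℕ × Fin 4) := (1, c) :: List.replicate t.length ((1 : ℕ), (0 : Fin 4)) with hl
  have hp₀ : 2 ≤ p₀.1 := hs p₀ (by simp)
  have ht1 : ∀ p ∈ t, 1 ≤ p.1 := fun p hp => le_trans (by decide) (hs p (by simp [hp]))
  have hkpos : ∀ p ∈ p₀ :: t, 1 ≤ p.1 := fun p hp => le_trans (by decide) (hs p hp)
  have hav₀ : psAv (-c) 0 (k₀.map Prod.snd) = true := by
    have h := psAv_shift c 0 _ hav
    rw [zero_sub, List.map_cons] at h
    obtain ⟨⟨h1, h2⟩, h3⟩ := psAv_cons.1 h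
    rw [hk₀, List.map_cons]
    refine psAv_cons.2 ⟨⟨?_, ?_⟩, ?_⟩
    · show (0 : Fin 4) + (p₀.2 - c) ≠ 0
      rwa [zero_add, sub_eq_neg_add]
    · show (0 : Fin 4) + (p₀.2 - c) ≠ -c
      rwa [zero_add, sub_eq_neg_add]
    · show psAv (-c) ((0 : Fin 4) + (p₀.2 - c)) ((lowerParts t).map Prod.snd) = true
      have : (lowerParts t).map Prod.snd = t.map Prod.snd := by simp [lowerParts, List.map_map, Function.comp_def]
      rw [this, zero_add, sub_eq_neg_add]; exact h3
  rw [List.map_cons] at hav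
  obtain ⟨⟨he₀, he₀'⟩, -⟩ := psAv_cons.1 hav
  rw [zero_add] at he₀ he₀'
  have hk₀pos : ∀ p ∈ k₀, 1 ≤ p.1 := by
    intro p hp
    rcases List.mem_cons.1 hp with rfl | hp
    · dsimp only; omega
    · obtain ⟨q, hq, rfl⟩ := List.mem_map.1 hp
      have := hs q (by simp [hq]); dsimp only; omega
  have hk₀conv : IsConvergentIdx k₀ :=
    isConvergentIdx_cons (by omega) (fun _ h0 => he₀' (sub_eq_zero.1 h0))
      fun p hp => hk₀pos p (List.mem_cons_of_mem _ hp)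
  have hlpos : ∀ p ∈ l, 1 ≤ p.1 := by
    intro p hp
    rcases List.mem_cons.1 hp with rfl | hp
    · exact le_rfl
    · rw [(List.eq_of_mem_replicate hp : p = (1, 0))]
  have hlconv : IsConvergentIdx l := isConvergentIdx_cons le_rfl (fun _ => hc) fun p hp => hlpos p (List.mem_cons_of_mem _ hp)
  have hlen : k₀.length = l.length := by simp [hk₀, hl, lowerParts]
  have hmerge : mergeIdx k₀ l = p₀ :: t := by
    rw [hk₀, hl, mergeIdx, mergeIdx_lowerParts t ht1, Nat.sub_add_cancel (le_trans (by decide) hp₀), sub_add_cancel]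
  have hcl : psConst c 0 (l.map Prod.snd) = true := by
    rw [hl, List.map_cons]
    exact psConst_cons.2 ⟨by rw [zero_add], by rw [zero_add]; exact psConst_zeros c t.length⟩
  -- weights and counts
  have hwt : wt k₀ + wt l = wt (p₀ :: t) := by
    have h1 := wt_lowerParts t ht1
    have h2 := wt_ones t.length
    have e1 : wt k₀ = (p₀.1 - 1) + wt (lowerParts t) := by simp [hk₀, wt]
    have e2 : wt l = 1 + wt (List.replicate t.length ((1 : ℕ), (0 : Fin 4))) := by simp [hl, wt]
    have e3 : wt (p₀ :: t) = p₀.1 + wt t := by simp [wt]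
    omega
  have h4k : (word (p₀ :: t)).count 4 + (p₀ :: t).length = wt (p₀ :: t) := count_four_wordAux 0 _ hkpos
  have h4k₀ : (word k₀).count 4 + k₀.length = wt k₀ := count_four_wordAux 0 _ hk₀pos
  have h4l : (word l).count 4 + l.length = wt l := count_four_wordAux 0 _ hlpos
  have hk₀len : k₀.length = (p₀ :: t).length := by simp [hk₀, lowerParts]
  have h0c : (0 : Fin 4) + c ≠ 0 := by rwa [zero_add]
  have h0k₀ : (word k₀).count 0 = 0 :=
    count_zero_wordAux 0 k₀ (by simpa using e1ok_of_psAv c 0 0 _ (Or.inl rfl) hav₀)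
  have h0l : (word l).count 0 = 0 :=
    count_zero_wordAux 0 l (by simpa using e1ok_of_psConst c 0 0 _ h0c hcl)
  have htop := fds_top hk₀conv hlconv (e0Lower (word (p₀ :: t))) ?_ ?_
  · rw [filter_stuffleIdx_length_eq k₀ l hlen, hmerge, List.map_singleton, List.sum_singleton] at htop
    exact htop
  · intro j hj hjl
    obtain ⟨hjwt, hjlen, hjpos⟩ := stuffle_wt k₀ l j hj
    have hjpos := hjpos hk₀pos hlpos
    have h4j : (word j).count 4 + j.length = wt j := count_four_wordAux 0 j hjpos
    have h0j : (word j).count 0 = 0 :=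
      count_zero_wordAux 0 j (by simpa using e1ok_stuffle_av c k₀ l 0 0 h0c (Or.inl rfl) hav₀ hcl j hj)
    have hjne : j ≠ [] := by
      rintro rfl
      simp only [List.length_nil, Nat.le_zero, List.length_eq_zero_iff] at hjlen
      exact hjl (by rw [hjlen])
    refine sym_mem_e0Lower ?_ (isConvergent_word_of_count_zero hjne h0j) h0j ?_
    · rw [length_word j hjpos, length_word _ hkpos]; change wt j = wt (p₀ :: t); omega
    · have : (p₀ :: t).length < j.length := by rw [← hk₀len]; omega
      omega
  · refine toQ_shuffle_mem _ _ _ fun w hw => ?_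
    have hperm := MZV.perm_of_mem_shuffleWord _ _ hw
    refine sym_mem_e0Lower ?_ ?_ ?_ ?_
    · rw [hperm.length_eq, List.length_append, length_word k₀ hk₀pos, length_word l hlpos,
        length_word _ hkpos]; change wt k₀ + wt l = wt (p₀ :: t); exact hwt
    · exact isConvergent_of_mem_shuffleWord (isConvergent_word hk₀conv) (isConvergent_word hlconv) hw
    · rw [hperm.count_eq, List.count_append, h0k₀, h0l]
    · rw [hperm.count_eq, List.count_append]
      have hl1 : 1 ≤ l.length := by simp [hl]
      omega

end Summit.KontsevichZagierPeriods.OctahedralSymmetry.OctaSpan.RegularE0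

end
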